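import Literature.Analysis.Fourier.GermIdentity
import Literature.Analysis.Fourier.TorusProductClass
import Literature.NumberTheory.Transcendental.PullbackLowestCoefficient
import Mathlib.Tactic
import HarnessLib

/-!
# The analytic pullback on the torus: coefficients `a_𝛎 = Σ_𝛍 β_𝛍 Π_s t_s(μ_s, ν_s)` (CDT eq. (6.16))

Calegari–Dimitrov–Tang, arXiv:2408.15403, §6.4 (p. 51). For one-variable data `Φ_s, h_s`
(holomorphic on `|z| ≤ R`, `R > 1`, `Φ_s(0) = 0`, `h_s(0) = 1`), functions `f_i` holomorphic on
`|x| ≤ ρ` with Taylor coefficients `b_q(f_i)`, holomorphic `u_{s,i}` agreeing with `h_s · (f_i ∘ Φ_s)`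
near `0` (the pole-cleared pullbacks), and a finite template `Σ_j c_j 𝐱^{𝐤_j} Π_s f_{i_j(s)}(x_s)`, the
pulled-back function `G = Σ_j c_j Π_s Φ_s^{k_j(s)} u_{s, i_j(s)}` lies in the product class of
`TorusProductClass`, and its torus coefficients `sumProdCoeff` are exactly the `pullCoeff β t` of
`PullbackLowestCoefficient` with `t_s(μ, r) = [z^r](Φ_s^μ h_s)` (a `TransferData` with
`λ_s = Φ_s'(0)`) and `β_𝛍 = Σ_{j : 𝐤_j ≤ 𝛍} c_j Π_s b_{μ_s − k_j(s)}(f_{i_j(s)})` the `𝐱^𝛍`-coefficient of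
the template:

* `transferData_taylorCoeff` — (a) the transfer data (the per-factor germ identity is
  `TorusCoeff.taylorCoeff_pow_mul_pullback` of `GermIdentity`);
* `sumProdCoeff_eq_pullCoeff` — (b) the identification, eq. (6.16).

No named facts.

## References

* [CalegariDimitrovTang2024] arXiv:2408.15403, §6.4 eqs. (6.15)–(6.16) (p. 51).
-/

noncomputable section

open Complex Metric Filter Finset Literature.Analysis.Fourier.TorusCoeff

open scoped Real NNReal Topology

namespace Literature.NumberTheory.Transcendental

namespace CalegariDimitrovTang

variable {d : ℕ}

/-- **(a) The transfer data** `t_s(μ, r) = [z^r](Φ_s^μ h_s)`: zero below the diagonal and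
`Φ_s'(0)^μ` on it (`Φ_s(0) = 0`, `h_s(0) = 1`). [cite: CalegariDimitrovTang2024, §6.4 eq. (6.16)] -/
theorem transferData_taylorCoeff (Φ h : Fin d → ℂ → ℂ) {R : ℝ≥0} (hR : 0 < R)
    (hΦ : ∀ s, DifferentiableOn ℂ (Φ s) (closedBall 0 R)) (hΦ0 : ∀ s, Φ s 0 = 0)
    (hh : ∀ s, DifferentiableOn ℂ (h s) (closedBall 0 R)) (hh1 : ∀ s, h s 0 = 1) :
    TransferData (fun s μ r => taylorCoeff (fun z => Φ s z ^ μ * h s z) R r) (fun s => deriv (Φ s) 0) where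
  below s μ r hr := taylorCoeff_comp_pow_mul_of_lt hR (hΦ s) (hΦ0 s) (hh s) hr
  diag s μ := by
    show taylorCoeff (fun z => Φ s z ^ μ * h s z) R μ = deriv (Φ s) 0 ^ μ
    rw [taylorCoeff_comp_pow_mul_self hR (hΦ s) (hΦ0 s) (hh s), hh1 s, mul_one]

/-- The `𝐱^𝛍`-coefficient of the template `Σ_j c_j 𝐱^{𝐤_j} Π_s f_{i_j(s)}(x_s)`:
`β_𝛍 = Σ_{j : 𝐤_j ≤ 𝛍} c_j Π_s b_{μ_s − k_j(s)}(f_{i_j(s)})`. [cite: CalegariDimitrovTang2024, §6.4] -/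
def templateCoeff {ι κ : Type*} (S : Finset ι) (c : ι → ℂ) (iof : ι → Fin d → κ) (kof : ι → Fin d → ℕ)
    (b : κ → ℕ → ℂ) (μ : Fin d → ℕ) : ℂ :=
  ∑ j ∈ S, if ∀ s, kof j s ≤ μ s then c j * ∏ s, b (iof j s) (μ s - kof j s) else 0

/-- Reindexing one factor family: `Σ_{𝐪 ≤ 𝛎} Π_s b(q_s) t_s(k_s + q_s, ν_s) = Σ_{𝐤 ≤ 𝛍 ≤ 𝛎} Π_s b(μ_s − k_s) t_s(μ_s, ν_s)`
when `t` vanishes below the diagonal. [folklore] -/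
theorem sum_box_shift (t : Fin d → ℕ → ℕ → ℂ) (hbelow : ∀ s μ r, r < μ → t s μ r = 0)
    (bs : Fin d → ℕ → ℂ) (k ν : Fin d → ℕ) :
    ∑ q ∈ Fintype.piFinset (fun s => Finset.range (ν s + 1)), ∏ s, bs s (q s) * t s (k s + q s) (ν s) =
      ∑ μ ∈ (Fintype.piFinset fun s => Finset.range (ν s + 1)).filter (fun μ => ∀ s, k s ≤ μ s),
        ∏ s, bs s (μ s - k s) * t s (μ s) (ν s) := by
  classical
  -- drop the terms with some `k s + q s > ν s`
  rw [← Finset.sum_filter_of_ne (p := fun q => ∀ s, k s + q s ≤ ν s)]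
  · refine Finset.sum_nbij' (fun q => fun s => k s + q s) (fun μ => fun s => μ s - k s) ?_ ?_ ?_ ?_ ?_
    · intro q hq
      rw [Finset.mem_filter, Fintype.mem_piFinset] at hq ⊢
      exact ⟨fun s => Finset.mem_range.mpr (Nat.lt_succ_of_le (hq.2 s)), fun s => Nat.le_add_right _ _⟩
    · intro μ hμ
      rw [Finset.mem_filter, Fintype.mem_piFinset] at hμ ⊢
      refine ⟨fun s => Finset.mem_range.mpr ?_, fun s => ?_⟩
      · have := Finset.mem_range.mp (hμ.1 s)
        show μ s - k s < ν s + 1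
        omega
      · have h1 := Finset.mem_range.mp (hμ.1 s)
        have h2 := hμ.2 s
        show k s + (μ s - k s) ≤ ν s
        omega
    · intro q hq
      funext s; simp
    · intro μ hμ
      rw [Finset.mem_filter] at hμ
      funext s; have := hμ.2 s; simp only; omega
    · intro q hq
      refine Finset.prod_congr rfl fun s _ => ?_
      simp
  · intro q hq hne
    by_contra hnot
    push Not at hnot
    obtain ⟨s, hs⟩ := hnot
    exact hne (Finset.prod_eq_zero (Finset.mem_univ s) (by rw [hbelow s _ _ hs, mul_zero]))

/-- **(b) The identification, CDT eq. (6.16)**: the torus coefficients of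
`G = Σ_j c_j Π_s Φ_s^{k_j(s)} u_{s,i_j(s)}` are `pullCoeff β t` with `β = templateCoeff` and
`t_s(μ,r) = [z^r](Φ_s^μ h_s)`. [cite: CalegariDimitrovTang2024, §6.4 eq. (6.16) (p. 51)] -/
theorem sumProdCoeff_eq_pullCoeff {ι κ : Type*} (S : Finset ι) (c : ι → ℂ) (iof : ι → Fin d → κ)
    (kof : ι → Fin d → ℕ) (Φ h : Fin d → ℂ → ℂ) (u : Fin d → κ → ℂ → ℂ) (f : κ → ℂ → ℂ)
    {R ρ : ℝ≥0} (hR : 0 < R) (hρ : 0 < ρ)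
    (hΦ : ∀ s, DifferentiableOn ℂ (Φ s) (closedBall 0 R)) (hΦ0 : ∀ s, Φ s 0 = 0)
    (hh : ∀ s, DifferentiableOn ℂ (h s) (closedBall 0 R))
    (hu : ∀ s i, DifferentiableOn ℂ (u s i) (closedBall 0 R))
    (hf : ∀ i, DifferentiableOn ℂ (f i) (closedBall 0 ρ))
    (hgerm : ∀ s i, u s i =ᶠ[𝓝 0] fun z => h s z * f i (Φ s z)) (ν : Fin d → ℕ) :
    sumProdCoeff S c (fun j s z => Φ s z ^ kof j s * u s (iof j s) z) R ν =
      pullCoeff (templateCoeff S c iof kof fun i q => taylorCoeff (f i) ρ q)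
        (fun s μ r => taylorCoeff (fun z => Φ s z ^ μ * h s z) R r) ν := by
  classical
  set t : Fin d → ℕ → ℕ → ℂ := fun s μ r => taylorCoeff (fun z => Φ s z ^ μ * h s z) R r with ht
  set b : κ → ℕ → ℂ := fun i q => taylorCoeff (f i) ρ q with hb
  have hbelow : ∀ s μ r, r < μ → t s μ r = 0 := fun s μ r hr =>
    taylorCoeff_comp_pow_mul_of_lt hR (hΦ s) (hΦ0 s) (hh s) hr
  set box := Fintype.piFinset fun s => Finset.range (ν s + 1) with hbox
  -- expand the left side factorwise
  have hL : sumProdCoeff S c (fun j s z => Φ s z ^ kof j s * u s (iof j s) z) R ν =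
      ∑ j ∈ S, c j * ∑ μ ∈ box.filter (fun μ => ∀ s, kof j s ≤ μ s),
        ∏ s, b (iof j s) (μ s - kof j s) * t s (μ s) (ν s) := by
    unfold sumProdCoeff
    refine Finset.sum_congr rfl fun j _ => ?_
    congr 1
    have hfac : ∀ s, taylorCoeff (fun z => Φ s z ^ kof j s * u s (iof j s) z) R (ν s) =
        ∑ q ∈ Finset.range (ν s + 1), b (iof j s) q * t s (kof j s + q) (ν s) := fun s =>
      taylorCoeff_pow_mul_pullback hR hρ (hΦ s) (hΦ0 s) (hh s) (hu s _) (hf _) (hgerm s _) _ _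
    simp_rw [hfac]
    rw [Finset.prod_univ_sum, hbox]
    exact sum_box_shift t hbelow (fun s => b (iof j s)) (kof j) ν
  -- expand the right side
  have hRt : pullCoeff (templateCoeff S c iof kof b) t ν =
      ∑ j ∈ S, c j * ∑ μ ∈ box.filter (fun μ => ∀ s, kof j s ≤ μ s),
        ∏ s, b (iof j s) (μ s - kof j s) * t s (μ s) (ν s) := by
    unfold pullCoeff templateCoeff
    rw [← hbox]
    simp_rw [Finset.sum_mul, Finset.sum_comm (s := box), Finset.sum_filter, Finset.mul_sum]
    refine Finset.sum_congr rfl fun j _ => Finset.sum_congr rfl fun μ _ => ?_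
    split_ifs with hk
    · rw [Finset.prod_mul_distrib]; ring
    · simp
  rw [hL, ← hRt]

end CalegariDimitrovTang

end Literature.NumberTheory.Transcendental
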